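import Mathlib.Analysis.InnerProductSpace.PiL2
import Mathlib.Tactic.Module
import Literature.MathematicalPhysics.QuantumFieldTheory.Balaban1983to89.B6Eq242LocalPropagator
import Literature.MathematicalPhysics.QuantumFieldTheory.Balaban1983to89.B6Eq230GaussianRoute
import Literature.MathematicalPhysics.QuantumFieldTheory.Balaban1983to89.B1
import Literature.MathematicalPhysics.QuantumFieldTheory.Balaban1983to89.B6SectAOperatorsV1

/-!
# `Balaban1983to89.B6Eq241TwoLevelWeights` — T. Bałaban, *Propagators and renormalization transformations for lattice
gauge theories. II*, Commun. Math. Phys. **96** (1984) 223–250 [Balaban1984PropagatorsII], (2.41) p. 230 with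
(2.13)–(2.14) p. 225: **the effective two-level averaging form obtained by integrating out the intermediate block field
`ω` IS the printed two-level weight `a_j(1 − 1_Λ) + a_{j+1}L^{d−2}Q′*1_{Λ′}Q′` with `a_{j+1} = aa_j/(aL^{−2} + a_j)`**
— the identification *"On the basis of the formulas (2.12), (2.13) [1]"* for the GENUINE block structure of a cube
meeting `B^j(Λ_j)` and `B^{j+1}(Λ_{j+1})`, KIND model instance (block-mean carriers, every block of `L^d` sub-blocks)

statement-level skeleton of published theorems with citation tags; proofs where landed; nothing here is a claim about the Yang–Mills mass gap.
PDF held: `paper:balaban1984-cmp96-propagators-rt-ii` (journal page = PDF page + 222); p. 230 [PDF 8] read from the ×2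
render `run/shared/lean/pub/pub-balaban/b2b-balaban-ref1/pages/1984-cmp96-propagators-rt-II/1984-cmp96-propagators-rt-II-p008-x2.png`,
p. 225 [PDF 3] from `…-p003-x2.png`.

CITATION HEADER (cell `lit-balaban`, unit `lit-balaban-p21` gen 7 — Phase-2 proof seat p21; HOME
`run/shared/lean/pub/lit-balaban/`; SKELETON rows **B6.Eq2.41** and **B6.Eq2.13** of `HOME/lit-balaban-r03/ROWS-B6.md`
(fold owner r03); TAKING line HOME/STATUS.md 2026-08-21T10:56Z).
IMPORTED BY NAME, not modified: `…B6Eq242LocalPropagator` (r03 g2: the abstract carriers `b0`, `kForm`, `deltaPrimeBox`,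
`mj`, `gPrimeBox`, `cInv` of (2.41)–(2.42), the Woodbury identity `deltaPrimeBox_comp_gPrimeBox`, the ω-representation
`eq241_fibre`, the Gaussian route `eq242`), whose docstring records *"NOT CLAIMED: the identification
`Q′*aQ′↾_□ = Q′_j*KQ′_j` itself (row B1.Eq2.12)"* — THIS FILE PROVES THAT IDENTIFICATION for the genuine block-mean
carriers; `…B1` (`B1.aSeq`, the sequence `a_k` of [Balaban1982Higgs1] (2.13)–(2.15), `aSeq_succ`);
`…B6Eq230GaussianRoute` (p22: `Z_pos`, positivity of Gaussian normalisations); `…B6SectAOperatorsV1` (p21 g5: the `ℓ²`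
pairing lemma `inner_eq_sum` only).

WHAT THE PAPER PRINTS (verbatim).  p. 225: *"where Δ′_a = Δ + Q′*aQ′ and the operator Q′*aQ′ is given by the quadratic
form ⟨λ, Q′*aQ′λ⟩ = Σ_{j=0}^k Σ_{y∈Λ_j} a_j(L^jη)^{d−2}|(Q′_jλ)(y)|². (2.14)  The numbers a_j satisfy the recursive
equations a_{j+1} = aa_j/(aL^{−2} + a_j), a₁ = a (see [1, 2.13 and 2.15])"*.  p. 230: *"If □ intersects both domains
B^j(Λ_j) and B^{j+1}(Λ_{j+1}), then we express G′(□) in terms of operators introduced in the paper. On the basis of the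
formulas (2.12), (2.13) [1] we have
e^{½⟨f,G′(□)f⟩} = Z⁻¹∫dλ exp[−½⟨λ,(Δ_□^{L^{−j},N} + Q′*aQ′↾_□)λ⟩ + ⟨λ,f⟩]
 = Z′⁻¹∫dω↾_Λ exp[−½aL^{d−2}Σ_{y∈Λ′}|(Q′ω)(y)|²] · ∫dλ exp[−½a_j‖ω − Q′_jλ‖² − ½⟨λ,Δ_□^{L^{−j},N}λ⟩ + ⟨λ,f⟩], (2.41)
where Λ = □^{(j)} ∩ B(Λ_{j+1}) and ω is equal to 0 beyond Λ."*

DICTIONARY (genuine carriers; L^{−j} units as in (2.40)–(2.41): the level-`j` blocks have unit side, `(L^jη)^{d−2} = 1`,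
`(L^{j+1}η)^{d−2} = L^{d−2}`).  `I` = the finite set `□^{(j)}` of level-`j` blocks of the cube (block fields
`U = ℓ²(I)`); `S` = the blocks inside `Λ = □^{(j)} ∩ B(Λ_{j+1})`, placed in `I` by an INJECTION `ι : S ↪ I` (fields
`W = ℓ²(S)` = the `ω↾_Λ`); `J` = `Λ′`, the `(j+1)`-blocks, `σ : S → J` the block map, EVERY block having exactly `n` (= `L^d`)
sub-blocks (`hfib`); `Q′ω(y) = n⁻¹Σ_{σ s = y} ω(s)` = the `L`-block mean (`Qav`; its `ℓ²`-adjoint `Qavs`);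
`emb` = *"ω is equal to 0 beyond Λ"* (extension by zero), `embs` = restriction to `Λ` (its adjoint); the ω-form of
(2.41) `Bq = β·Q′*Q′` with `β = aL^{d−2}`; `α = a_j`.  All pairings are the plain `ℓ²` pairings of the display.

WHAT IS PROVED HERE (0 sorry, 0 new named facts; every `def` has a body).
§1 carriers and their algebra: `inner_embs_left` (`embs = emb*`), `inner_Qavs_left` (`Qavs = Q′*`), `embs_emb = id`,
`inner_emb_embs` (`⟨u, 1_Λu⟩ = ‖u↾_Λ‖²`), the block projection `blockProj = n·Q′*Q′` (fibre mean, `blockProj_apply`) is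
idempotent (`blockProj_comp_blockProj`, uses `hfib`).
§2 **`b0_eq`**: r03's `B₀ = Bq + a_j·embs emb = (β/n)·blockProj + a_j·1`; **`b0Inv`** = `a_j⁻¹·1 − (β/n)/(a_j(a_j + β/n))·blockProj`
is its TWO-SIDED inverse (`b0_comp_b0Inv`, `b0Inv_comp_b0`) — the block-diagonal inversion of [Balaban1983RegularityDecay]
(3.3) (`(A𝟙𝟙ᵀ + B)⁻¹`), here for the operator of (2.41).
§3 **`kForm_eq`** (THE IDENTIFICATION): `K = a_j − a_j²·emb B₀⁻¹embs = a_j·(1 − emb embs) + (a_jβ/n)/(a_j + β/n)·emb blockProj embs`;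
as a quadratic form **`inner_kForm`**: `⟨u,Ku⟩ = a_j(‖u‖² − ‖u↾_Λ‖²) + (n a_j β/(n a_j + β))·Σ_{y∈Λ′}|(Q′u↾_Λ)(y)|²`;
**`coeff_eq_aSeq_succ`**: with `n = L^d`, `β = aL^{d−2}`, `a_j = B1.aSeq a L j` (`j ≥ 1`) the coefficient is
`L^{d−2}·B1.aSeq a L (j+1)` — i.e. **`inner_kForm_printed`**: `⟨u,Ku⟩ = a_jΣ_{y∈□^{(j)}∖Λ}|u(y)|² + a_{j+1}L^{d−2}Σ_{y′∈Λ′}|(Q′u)(y′)|²`,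
the level-`j` and level-`(j+1)` terms of (2.14) on the cube, `a_{j+1} = aa_j/(aL^{−2}+a_j)`.
§4 consequences for r03's abstract theorems, now about the GENUINE two-level cube operator: **`form_deltaPrimeBox`**
(`⟨λ,(Δ_□ + Q′*aQ′↾_□)λ⟩ = ⟨λ,Δ_□λ⟩ + a_jΣ_{y∉Λ}|(Q′_jλ)(y)|² + a_{j+1}L^{d−2}Σ_{y′}|(Q′Q′_jλ)(y′)|²` for
`deltaPrimeBox`), **`eq241_twoLevel`** (r03's `eq241_fibre` with `hE`/`hBq`/`hB` DISCHARGED: integrating `ω` against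
`exp[−½aL^{d−2}Σ|Q′ω|² − ½a_j‖ω − u‖²]` produces `exp[−½⟨u,Ku⟩]·Z_{B₀}` with the printed `K`), **`Z_b0_pos`**
(`Z_{B₀} > 0` for additive Haar `dω`), **`eq241_first_line`** (the first equality of (2.41) for the genuine operator,
λ-pointwise; integrated with `dλ` outside it is the printed pair of lines, whose `dω`-outside order is the same number by
Tonelli — not re-derived), **`deltaPrimeBox_comp_gPrimeBox_twoLevel`** (the Woodbury `G′(□)` of (2.42) is a right inverse
of the genuine `Δ_□ + Q′*aQ′↾_□`, hypothesis `hB` discharged).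
HONEST SCOPE.  The Laplacian `Δ_□^{L^{−j},N}`, `Q′_j`, `G′_j(□)`, `C_Λ^{(j)}(□)` stay abstract here (any symmetric `lap`, any
`Qj` with adjoint `Qjs`, right inverses as hypotheses, exactly as in r03's file): this file settles the WEIGHTS of the
two-level form, not the estimates (2.43)–(2.44).
-/

noncomputable section

open MeasureTheory Finset
open scoped InnerProductSpace

namespace Literature.MathematicalPhysics.QuantumFieldTheory.Balaban1983to89.B6Eq241TwoLevelWeights

open B6Eq242LocalPropagator (b0 kForm deltaPrimeBox mj gPrimeBox cInv)

/-! ## §0. Plumbing: linear maps of function spaces read on `ℓ²` -/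

section Wrap

variable {ι κ : Type*}

/-- A linear map of function spaces read between the Euclidean spaces `ℓ²(ι) → ℓ²(κ)` (plain `ℓ²` pairings of (2.41)). [folklore] -/
def onEuc (f : (ι → ℝ) →ₗ[ℝ] (κ → ℝ)) : EuclideanSpace ℝ ι →ₗ[ℝ] EuclideanSpace ℝ κ :=
  (WithLp.linearEquiv 2 ℝ (κ → ℝ)).symm.toLinearMap ∘ₗ f ∘ₗ (WithLp.linearEquiv 2 ℝ (ι → ℝ)).toLinearMap

/-- components of `onEuc`. [cite: Balaban1984PropagatorsII, (2.41) p.230] -/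
@[simp] theorem onEuc_apply (f : (ι → ℝ) →ₗ[ℝ] (κ → ℝ)) (x : EuclideanSpace ℝ ι) (k : κ) :
    onEuc f x k = f (WithLp.ofLp x) k := rfl

/-- `‖x‖² = Σ_i x_i²` on `ℓ²`. [folklore] -/
private theorem norm_sq_eq_sum_sq [Fintype ι] (x : EuclideanSpace ℝ ι) : ‖x‖ ^ 2 = ∑ i, x i ^ 2 := by
  rw [EuclideanSpace.norm_sq_eq]
  exact Finset.sum_congr rfl fun i _ => by rw [Real.norm_eq_abs, sq_abs]

end Wrap

/-! ## §1. The genuine two-level block carriers of (2.41) -/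

section Carriers

variable {I S J : Type*}

/-- restriction to `Λ` at function level: `u ↦ u ∘ ι`. [cite: Balaban1984PropagatorsII, (2.41) p.230 («ω↾_Λ»)] -/
def restrFn (ι : S → I) : (I → ℝ) →ₗ[ℝ] (S → ℝ) := LinearMap.funLeft ℝ ℝ ι

/-- extension by zero beyond `Λ` at function level. [cite: Balaban1984PropagatorsII, (2.41) p.230 («ω is equal to 0 beyond Λ»)] -/
def extFn [Fintype S] [DecidableEq I] (ι : S → I) : (S → ℝ) →ₗ[ℝ] (I → ℝ) where
  toFun w i := ∑ s, if ι s = i then w s else 0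
  map_add' u w := funext fun i => by
    simp only [Pi.add_apply, ← Finset.sum_add_distrib]
    exact Finset.sum_congr rfl fun s _ => by split_ifs <;> simp
  map_smul' r w := funext fun i => by
    simp only [Pi.smul_apply, smul_eq_mul, RingHom.id_apply, Finset.mul_sum]
    exact Finset.sum_congr rfl fun s _ => by split_ifs <;> simp

/-- the `L`-block mean at function level: `(Q′ω)(y) = n⁻¹Σ_{σ s = y} ω(s)`. [cite: Balaban1984PropagatorsII, (2.41) p.230 («(Q′ω)(y)»)] -/
def meanFn [Fintype S] [DecidableEq J] (σ : S → J) (n : ℕ) : (S → ℝ) →ₗ[ℝ] (J → ℝ) where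
  toFun w y := (n : ℝ)⁻¹ * ∑ s, if σ s = y then w s else 0
  map_add' u w := funext fun y => by
    simp only [Pi.add_apply, ← mul_add, ← Finset.sum_add_distrib]
    congr 1
    exact Finset.sum_congr rfl fun s _ => by split_ifs <;> simp
  map_smul' r w := funext fun y => by
    simp only [Pi.smul_apply, smul_eq_mul, RingHom.id_apply, Finset.mul_sum]
    exact Finset.sum_congr rfl fun s _ => by split_ifs <;> ring

/-- the adjoint of the block mean at function level: `(Q′*v)(s) = n⁻¹v(σ s)`. [folklore] -/
def meanAdjFn (σ : S → J) (n : ℕ) : (J → ℝ) →ₗ[ℝ] (S → ℝ) where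
  toFun v s := (n : ℝ)⁻¹ * v (σ s)
  map_add' u v := funext fun s => by simp only [Pi.add_apply, mul_add]
  map_smul' r v := funext fun s => by simp only [Pi.smul_apply, smul_eq_mul, RingHom.id_apply]; ring

variable (ι : S → I) (σ : S → J) (n : ℕ)

/-- `embs` = restriction of a level-`j` block field to `Λ` (the adjoint of the extension by zero). [cite: Balaban1984PropagatorsII, (2.41) p.230] -/
def embs : EuclideanSpace ℝ I →ₗ[ℝ] EuclideanSpace ℝ S := onEuc (restrFn ι)

/-- `emb` = *"ω is equal to 0 beyond Λ"*: extension by zero of a field on `Λ`. [cite: Balaban1984PropagatorsII, (2.41) p.230] -/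
def emb [Fintype S] [DecidableEq I] : EuclideanSpace ℝ S →ₗ[ℝ] EuclideanSpace ℝ I := onEuc (extFn ι)

/-- `Q′` of (2.41): the `L`-block mean `ℓ²(Λ) → ℓ²(Λ′)`. [cite: Balaban1984PropagatorsII, (2.41) p.230] -/
def Qav [Fintype S] [DecidableEq J] : EuclideanSpace ℝ S →ₗ[ℝ] EuclideanSpace ℝ J := onEuc (meanFn σ n)

/-- `Q′*`: the `ℓ²`-adjoint of the block mean. [cite: Balaban1984PropagatorsII, (2.41)–(2.42) p.230 («Q′*Q′ω»)] -/
def Qavs : EuclideanSpace ℝ J →ₗ[ℝ] EuclideanSpace ℝ S := onEuc (meanAdjFn σ n)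

/-- components of the restriction. [cite: Balaban1984PropagatorsII, (2.41) p.230] -/
@[simp] theorem embs_apply (u : EuclideanSpace ℝ I) (s : S) : embs ι u s = u (ι s) := rfl

/-- components of the extension by zero. [cite: Balaban1984PropagatorsII, (2.41) p.230] -/
theorem emb_apply [Fintype S] [DecidableEq I] (w : EuclideanSpace ℝ S) (i : I) :
    emb ι w i = ∑ s, if ι s = i then w s else 0 := rfl

/-- components of the block mean. [cite: Balaban1984PropagatorsII, (2.41) p.230] -/
theorem Qav_apply [Fintype S] [DecidableEq J] (w : EuclideanSpace ℝ S) (y : J) :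
    Qav σ n w y = (n : ℝ)⁻¹ * ∑ s, if σ s = y then w s else 0 := rfl

/-- components of the adjoint block mean. [cite: Balaban1984PropagatorsII, (2.41) p.230] -/
@[simp] theorem Qavs_apply (v : EuclideanSpace ℝ J) (s : S) : Qavs σ n v s = (n : ℝ)⁻¹ * v (σ s) := rfl

/-- the extension by zero evaluated on `Λ` returns the field (injective placement). [cite: Balaban1984PropagatorsII, (2.41) p.230] -/
theorem emb_apply_ι [Fintype S] [DecidableEq I] (hι : Function.Injective ι) (w : EuclideanSpace ℝ S) (s : S) :
    emb ι w (ι s) = w s := by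
  rw [emb_apply, Finset.sum_eq_single s]
  · rw [if_pos rfl]
  · intro s' _ hs'
    rw [if_neg fun h => hs' (hι h)]
  · intro h
    exact absurd (Finset.mem_univ s) h

/-- the extension by zero vanishes beyond `Λ`. [cite: Balaban1984PropagatorsII, (2.41) p.230 («ω is equal to 0 beyond Λ»)] -/
theorem emb_apply_of_notMem [Fintype S] [DecidableEq I] {i : I} (hi : ∀ s, ι s ≠ i) (w : EuclideanSpace ℝ S) :
    emb ι w i = 0 := by
  rw [emb_apply]
  exact Finset.sum_eq_zero fun s _ => by rw [if_neg (hi s)]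

/-- **`embs` is the adjoint of `emb`**: `⟨u↾_Λ, ω⟩ = ⟨u, emb ω⟩` (hypothesis `hE` of r03's theorems). [cite: Balaban1984PropagatorsII, (2.41) p.230] -/
theorem inner_embs_left [Fintype I] [Fintype S] [DecidableEq I] (u : EuclideanSpace ℝ I) (w : EuclideanSpace ℝ S) :
    ⟪embs ι u, w⟫_ℝ = ⟪u, emb ι w⟫_ℝ := by
  simp only [B6SectAOperatorsV1.inner_eq_sum, embs_apply, emb_apply]
  symm
  calc ∑ i, u i * ∑ s, (if ι s = i then w s else 0)
      = ∑ i, ∑ s, (if ι s = i then u i * w s else 0) := by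
        refine Finset.sum_congr rfl fun i _ => ?_
        rw [Finset.mul_sum]
        exact Finset.sum_congr rfl fun s _ => by split_ifs <;> simp
    _ = ∑ s, ∑ i, (if ι s = i then u i * w s else 0) := Finset.sum_comm
    _ = ∑ s, u (ι s) * w s := by
        refine Finset.sum_congr rfl fun s _ => ?_
        rw [Finset.sum_ite_eq]
        simp

/-- **`Qavs` is the adjoint of `Qav`**: `⟨Q′*v, ω⟩ = ⟨v, Q′ω⟩`. [cite: Balaban1984PropagatorsII, (2.41) p.230] -/
theorem inner_Qavs_left [Fintype S] [Fintype J] [DecidableEq J] (v : EuclideanSpace ℝ J) (w : EuclideanSpace ℝ S) :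
    ⟪Qavs σ n v, w⟫_ℝ = ⟪v, Qav σ n w⟫_ℝ := by
  simp only [B6SectAOperatorsV1.inner_eq_sum, Qavs_apply, Qav_apply]
  symm
  calc ∑ y, v y * ((n : ℝ)⁻¹ * ∑ s, if σ s = y then w s else 0)
      = ∑ y, ∑ s, (if σ s = y then (n : ℝ)⁻¹ * v y * w s else 0) := by
        refine Finset.sum_congr rfl fun y _ => ?_
        rw [Finset.mul_sum, Finset.mul_sum]
        exact Finset.sum_congr rfl fun s _ => by split_ifs <;> ring
    _ = ∑ s, ∑ y, (if σ s = y then (n : ℝ)⁻¹ * v y * w s else 0) := Finset.sum_comm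
    _ = ∑ s, (n : ℝ)⁻¹ * v (σ s) * w s := by
        refine Finset.sum_congr rfl fun s _ => ?_
        rw [Finset.sum_ite_eq]
        simp

/-- restriction ∘ extension = identity on `ℓ²(Λ)`. [cite: Balaban1984PropagatorsII, (2.41) p.230] -/
theorem embs_emb [Fintype S] [DecidableEq I] (hι : Function.Injective ι) : embs ι ∘ₗ emb ι = LinearMap.id := by
  refine LinearMap.ext fun w => PiLp.ext fun s => ?_
  simp only [LinearMap.comp_apply, embs_apply, LinearMap.id_apply]
  exact emb_apply_ι ι hι w s

/-- pointwise form of `embs_emb`. [cite: Balaban1984PropagatorsII, (2.41) p.230] -/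
theorem embs_emb_apply [Fintype S] [DecidableEq I] (hι : Function.Injective ι) (w : EuclideanSpace ℝ S) :
    embs ι (emb ι w) = w := by
  simpa only [LinearMap.comp_apply, LinearMap.id_apply] using LinearMap.congr_fun (embs_emb ι hι) w

/-- `⟨u, emb embs u⟩ = ‖u↾_Λ‖²`: the cut-off `1_Λ = emb∘embs` as a quadratic form. [cite: Balaban1984PropagatorsII, (2.41) p.230] -/
theorem inner_emb_embs [Fintype I] [Fintype S] [DecidableEq I] (u : EuclideanSpace ℝ I) :
    ⟪u, emb ι (embs ι u)⟫_ℝ = ‖embs ι u‖ ^ 2 := by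
  rw [← inner_embs_left, real_inner_self_eq_norm_sq]

/-- `‖u↾_Λ‖² = Σ_s u(ι s)²`. [cite: Balaban1984PropagatorsII, (2.41) p.230] -/
theorem norm_embs_sq [Fintype S] (u : EuclideanSpace ℝ I) : ‖embs ι u‖ ^ 2 = ∑ s, u (ι s) ^ 2 := by
  rw [norm_sq_eq_sum_sq]
  rfl

/-- `‖Q′ω‖² = Σ_{y∈Λ′}|(Q′ω)(y)|²` — the sum in the ω-exponent of (2.41). [cite: Balaban1984PropagatorsII, (2.41) p.230] -/
theorem norm_Qav_sq [Fintype S] [Fintype J] [DecidableEq J] (w : EuclideanSpace ℝ S) :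
    ‖Qav σ n w‖ ^ 2 = ∑ y, Qav σ n w y ^ 2 :=
  norm_sq_eq_sum_sq _

/-- the block projection `n·Q′*Q′` (fibrewise mean, replicated on the fibre). [folklore] -/
def blockProj [Fintype S] [DecidableEq J] : EuclideanSpace ℝ S →ₗ[ℝ] EuclideanSpace ℝ S :=
  (n : ℝ) • (Qavs σ n ∘ₗ Qav σ n)

/-- components of the block projection: the mean of `ω` over the block of `s`. [cite: Balaban1984PropagatorsII, (2.41) p.230] -/
theorem blockProj_apply [Fintype S] [DecidableEq J] (hn : n ≠ 0) (w : EuclideanSpace ℝ S) (s : S) :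
    blockProj σ n w s = (n : ℝ)⁻¹ * ∑ s', if σ s' = σ s then w s' else 0 := by
  have hn' : (n : ℝ) ≠ 0 := Nat.cast_ne_zero.mpr hn
  simp only [blockProj, LinearMap.smul_apply, LinearMap.comp_apply, PiLp.smul_apply, smul_eq_mul, Qavs_apply,
    Qav_apply]
  rw [← mul_assoc, mul_inv_cancel₀ hn', one_mul]

/-- `⟨ω, blockProj ω⟩ = n‖Q′ω‖²`. [cite: Balaban1984PropagatorsII, (2.41) p.230] -/
theorem inner_blockProj [Fintype S] [Fintype J] [DecidableEq J] (w : EuclideanSpace ℝ S) :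
    ⟪w, blockProj σ n w⟫_ℝ = (n : ℝ) * ‖Qav σ n w‖ ^ 2 := by
  simp only [blockProj, LinearMap.smul_apply, LinearMap.comp_apply, real_inner_smul_right]
  rw [real_inner_comm (Qavs σ n (Qav σ n w)) w, inner_Qavs_left, real_inner_self_eq_norm_sq]

/-- `blockProj` is symmetric. [cite: Balaban1984PropagatorsII, (2.41) p.230] -/
theorem inner_blockProj_left [Fintype S] [Fintype J] [DecidableEq J] (v w : EuclideanSpace ℝ S) :
    ⟪blockProj σ n v, w⟫_ℝ = ⟪v, blockProj σ n w⟫_ℝ := by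
  simp only [blockProj, LinearMap.smul_apply, LinearMap.comp_apply, real_inner_smul_left, real_inner_smul_right]
  congr 1
  rw [inner_Qavs_left, real_inner_comm (Qavs σ n (Qav σ n w)) v, inner_Qavs_left]
  exact real_inner_comm _ _

/-- the sum over a fibre of a quantity depending only on the block: `Σ_{s′: σ s′ = σ s} c = n·c` when every block
has `n` sub-blocks. [folklore] -/
private theorem sum_fibre_const [Fintype S] [DecidableEq J]
    (hfib : ∀ y : J, (Finset.univ.filter fun s : S => σ s = y).card = n) (s : S) (c : ℝ) :
    (∑ s' : S, if σ s' = σ s then c else 0) = (n : ℝ) * c := by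
  rw [← Finset.sum_filter, Finset.sum_const, hfib (σ s), nsmul_eq_mul]

/-- **`blockProj` is idempotent** (the mean of a block-constant field is the field): uses only that every `(j+1)`-block
contains exactly `n` level-`j` blocks. [cite: Balaban1984PropagatorsII, (2.41) p.230] -/
theorem blockProj_comp_blockProj [Fintype S] [DecidableEq J] (hn : n ≠ 0)
    (hfib : ∀ y : J, (Finset.univ.filter fun s : S => σ s = y).card = n) :
    blockProj σ n ∘ₗ blockProj σ n = blockProj σ n := by
  have hn' : (n : ℝ) ≠ 0 := Nat.cast_ne_zero.mpr hn
  refine LinearMap.ext fun w => PiLp.ext fun s => ?_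
  rw [LinearMap.comp_apply, blockProj_apply σ n hn, blockProj_apply σ n hn]
  -- on the fibre of `s` the inner block mean is the constant `blockProj w s`
  have h : ∀ s' : S, (if σ s' = σ s then blockProj σ n w s' else 0) =
      if σ s' = σ s then (n : ℝ)⁻¹ * ∑ t, (if σ t = σ s then w t else 0) else 0 := by
    intro s'
    split_ifs with hs
    · rw [blockProj_apply σ n hn, hs]
    · rfl
  rw [Finset.sum_congr rfl fun s' _ => h s', sum_fibre_const σ n hfib, ← mul_assoc, inv_mul_cancel₀ hn', one_mul]

/-- pointwise idempotence. [cite: Balaban1984PropagatorsII, (2.41) p.230] -/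
theorem blockProj_blockProj [Fintype S] [DecidableEq J] (hn : n ≠ 0)
    (hfib : ∀ y : J, (Finset.univ.filter fun s : S => σ s = y).card = n) (w : EuclideanSpace ℝ S) :
    blockProj σ n (blockProj σ n w) = blockProj σ n w := by
  simpa only [LinearMap.comp_apply] using LinearMap.congr_fun (blockProj_comp_blockProj σ n hn hfib) w

end Carriers

/-! ## §2. `B₀ = Bq + a_j·embs emb` and its explicit inverse ([3] (3.3) shape) -/

section BZero

variable {I S J : Type*} (ι : S → I) (σ : S → J) (n : ℕ)

/-- the ω-form of (2.41): `Bq = β·Q′*Q′`, `⟨ω, Bq ω⟩ = βΣ_{y∈Λ′}|(Q′ω)(y)|²`, `β = aL^{d−2}`. [cite: Balaban1984PropagatorsII, (2.41) p.230] -/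
def Bq [Fintype S] [DecidableEq J] (β : ℝ) : EuclideanSpace ℝ S →ₗ[ℝ] EuclideanSpace ℝ S :=
  β • (Qavs σ n ∘ₗ Qav σ n)

/-- `⟨ω, Bq ω⟩ = β‖Q′ω‖² = βΣ_{y∈Λ′}|(Q′ω)(y)|²` — the first exponent of the second line of (2.41). [cite: Balaban1984PropagatorsII, (2.41) p.230] -/
theorem inner_Bq [Fintype S] [Fintype J] [DecidableEq J] (β : ℝ) (w : EuclideanSpace ℝ S) :
    ⟪w, Bq σ n β w⟫_ℝ = β * ∑ y, Qav σ n w y ^ 2 := by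
  simp only [Bq, LinearMap.smul_apply, LinearMap.comp_apply, real_inner_smul_right]
  rw [real_inner_comm (Qavs σ n (Qav σ n w)) w, inner_Qavs_left, real_inner_self_eq_norm_sq, norm_Qav_sq]

/-- `Bq` is symmetric (hypothesis `hBq` of r03's theorems). [cite: Balaban1984PropagatorsII, (2.41) p.230] -/
theorem inner_Bq_left [Fintype S] [Fintype J] [DecidableEq J] (β : ℝ) (v w : EuclideanSpace ℝ S) :
    ⟪Bq σ n β v, w⟫_ℝ = ⟪v, Bq σ n β w⟫_ℝ := by
  simp only [Bq, LinearMap.smul_apply, LinearMap.comp_apply, real_inner_smul_left, real_inner_smul_right]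
  congr 1
  rw [inner_Qavs_left, real_inner_comm (Qavs σ n (Qav σ n w)) v, inner_Qavs_left]
  exact real_inner_comm _ _

/-- `Bq = (β/n)·blockProj`. [cite: Balaban1984PropagatorsII, (2.41) p.230] -/
theorem Bq_eq [Fintype S] [DecidableEq J] (hn : n ≠ 0) (β : ℝ) : Bq σ n β = (β / n) • blockProj σ n := by
  have hn' : (n : ℝ) ≠ 0 := Nat.cast_ne_zero.mpr hn
  rw [Bq, blockProj, smul_smul, div_mul_cancel₀ β hn']

/-- **r03's `B₀ = Bq + a_j·embs∘emb` on the genuine carriers is `(β/n)·blockProj + a_j·1`** (`embs∘emb = 1`).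
[cite: Balaban1984PropagatorsII, (2.41) p.230] -/
theorem b0_eq [Fintype S] [DecidableEq I] [DecidableEq J] (hι : Function.Injective ι) (hn : n ≠ 0) (α β : ℝ) :
    b0 (Bq σ n β) (emb ι) (embs ι) α = (β / n) • blockProj σ n + α • LinearMap.id := by
  rw [b0, embs_emb ι hι, Bq_eq σ n hn]

/-- **the explicit inverse `B₀⁻¹ = a_j⁻¹·1 − ((β/n)/(a_j(a_j + β/n)))·blockProj`** (block-diagonal; on each `(j+1)`-block
this is `(A𝟙𝟙ᵀ + B·1)⁻¹ = B⁻¹(1 − A/(NA+B)·𝟙𝟙ᵀ)` of [Balaban1983RegularityDecay] (3.3) with `A = β/n²`, `B = a_j`, `N = n`).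
[cite: Balaban1984PropagatorsII, (2.41) p.230] -/
def b0Inv [Fintype S] [DecidableEq J] (α β : ℝ) : EuclideanSpace ℝ S →ₗ[ℝ] EuclideanSpace ℝ S :=
  α⁻¹ • LinearMap.id - ((β / n) / (α * (α + β / n))) • blockProj σ n

/-- the scalar identity behind `B₀B₀⁻¹ = 1`: `cα⁻¹ − c·k − α·k = 0` for `k = c/(α(α+c))`. [folklore] -/
private theorem coef_identity {α c : ℝ} (hα : α ≠ 0) (hαc : α + c ≠ 0) :
    c * α⁻¹ - c * (c / (α * (α + c))) - α * (c / (α * (α + c))) = 0 := by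
  field_simp
  ring

/-- the scalar identity behind `B₀⁻¹B₀ = 1`. [folklore] -/
private theorem coef_identity' {α c : ℝ} (hα : α ≠ 0) (hαc : α + c ≠ 0) :
    α⁻¹ * c - c / (α * (α + c)) * c - c / (α * (α + c)) * α = 0 := by
  field_simp
  ring

/-- `nα + β ≠ 0` from `α + β/n ≠ 0`. [folklore] -/
private theorem n_mul_add_ne_zero {α β : ℝ} (hn : n ≠ 0) (hαβ : α + β / n ≠ 0) : (n : ℝ) * α + β ≠ 0 := by
  have hn' : (n : ℝ) ≠ 0 := Nat.cast_ne_zero.mpr hn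
  intro h
  apply hαβ
  have : α + β / n = ((n : ℝ) * α + β) / n := by field_simp
  rw [this, h, zero_div]

/-- `B₀B₀⁻¹ = 1`. [cite: Balaban1984PropagatorsII, (2.41) p.230] -/
theorem b0_comp_b0Inv [Fintype S] [DecidableEq I] [DecidableEq J] (hι : Function.Injective ι) (hn : n ≠ 0)
    (hfib : ∀ y : J, (Finset.univ.filter fun s : S => σ s = y).card = n) {α β : ℝ} (hα : α ≠ 0)
    (hαβ : α + β / n ≠ 0) :
    b0 (Bq σ n β) (emb ι) (embs ι) α ∘ₗ b0Inv σ n α β = LinearMap.id := by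
  rw [b0_eq ι σ n hι hn]
  refine LinearMap.ext fun w => ?_
  have hP := blockProj_blockProj σ n hn hfib w
  simp only [b0Inv, LinearMap.comp_apply, LinearMap.add_apply, LinearMap.sub_apply, LinearMap.smul_apply,
    LinearMap.id_apply, map_sub, map_smul, hP]
  have hcoef : β / n * α⁻¹ - β / n * (β / n / (α * (α + β / n))) - α * (β / n / (α * (α + β / n))) = 0 :=
    coef_identity hα hαβ
  have h2 : (β / n * α⁻¹ - β / n * (β / n / (α * (α + β / n))) - α * (β / n / (α * (α + β / n)))) • blockProj σ n w +
      (α * α⁻¹) • w = w := by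
    rw [hcoef, zero_smul, zero_add, mul_inv_cancel₀ hα, one_smul]
  refine Eq.trans ?_ h2
  module

/-- `B₀⁻¹B₀ = 1`. [cite: Balaban1984PropagatorsII, (2.41) p.230] -/
theorem b0Inv_comp_b0 [Fintype S] [DecidableEq I] [DecidableEq J] (hι : Function.Injective ι) (hn : n ≠ 0)
    (hfib : ∀ y : J, (Finset.univ.filter fun s : S => σ s = y).card = n) {α β : ℝ} (hα : α ≠ 0)
    (hαβ : α + β / n ≠ 0) :
    b0Inv σ n α β ∘ₗ b0 (Bq σ n β) (emb ι) (embs ι) α = LinearMap.id := by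
  rw [b0_eq ι σ n hι hn]
  refine LinearMap.ext fun w => ?_
  have hP := blockProj_blockProj σ n hn hfib w
  simp only [b0Inv, LinearMap.comp_apply, LinearMap.add_apply, LinearMap.sub_apply, LinearMap.smul_apply,
    LinearMap.id_apply, map_add, map_smul, hP]
  have hcoef : α⁻¹ * (β / n) - β / n / (α * (α + β / n)) * (β / n) - β / n / (α * (α + β / n)) * α = 0 :=
    coef_identity' hα hαβ
  have h2 : (α⁻¹ * (β / n) - β / n / (α * (α + β / n)) * (β / n) - β / n / (α * (α + β / n)) * α) • blockProj σ n w +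
      (α⁻¹ * α) • w = w := by
    rw [hcoef, zero_smul, zero_add, inv_mul_cancel₀ hα, one_smul]
  refine Eq.trans ?_ h2
  module

end BZero

/-! ## §3. THE IDENTIFICATION: `K = a_j(1 − 1_Λ) + a_{j+1}L^{d−2}·Q′*1_{Λ′}Q′` -/

section Identification

variable {I S J : Type*} (ι : S → I) (σ : S → J) (n : ℕ)

/-- **`kForm_eq` — r03's effective two-level form `K = a_j − a_j²·emb B₀⁻¹ embs` EQUALS
`a_j·(1 − emb∘embs) + (a_j(β/n)/(a_j + β/n))·emb∘blockProj∘embs`**: outside `Λ` the level-`j` weight `a_j` untouched,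
on `Λ` the level-`j` weight REPLACED by the block form with the harmonic-mean coefficient.  Operator identity
(`a_j ≠ 0`, `a_j + β/n ≠ 0`). [cite: Balaban1984PropagatorsII, (2.41) p.230 + (2.13)–(2.14) p.225] -/
theorem kForm_eq [Fintype S] [DecidableEq I] [DecidableEq J] {α β : ℝ} (hα : α ≠ 0) (hαβ : α + β / n ≠ 0) :
    kForm (emb ι) (embs ι) (b0Inv σ n α β) α =
      α • (LinearMap.id - emb ι ∘ₗ embs ι) +
        (α * (β / n) / (α + β / n)) • (emb ι ∘ₗ blockProj σ n ∘ₗ embs ι) := by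
  refine LinearMap.ext fun u => ?_
  simp only [kForm, b0Inv, LinearMap.sub_apply, LinearMap.add_apply, LinearMap.smul_apply, LinearMap.comp_apply,
    LinearMap.id_apply, map_sub, map_smul]
  have h1 : α * α * α⁻¹ = α := mul_inv_cancel_right₀ hα α
  have h2 : α * α * (β / n / (α * (α + β / n))) = α * (β / n) / (α + β / n) := by
    field_simp
  calc α • u - (α * α) • (α⁻¹ • emb ι (embs ι u) - (β / ↑n / (α * (α + β / ↑n))) • emb ι (blockProj σ n (embs ι u)))
      = α • u - (α * α * α⁻¹) • emb ι (embs ι u) +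
          (α * α * (β / n / (α * (α + β / n)))) • emb ι (blockProj σ n (embs ι u)) := by module
    _ = α • u - α • emb ι (embs ι u) + (α * (β / n) / (α + β / n)) • emb ι (blockProj σ n (embs ι u)) := by
        rw [h1, h2]
    _ = α • (u - emb ι (embs ι u)) + (α * (β / ↑n) / (α + β / ↑n)) • emb ι (blockProj σ n (embs ι u)) := by
        module

/-- **`inner_kForm` — the identification as a quadratic form**: `⟨u,Ku⟩ = a_j(‖u‖² − ‖u↾_Λ‖²) + (n a_jβ/(n a_j + β))·‖Q′(u↾_Λ)‖²`,
i.e. `a_jΣ_{y∈□^{(j)}∖Λ}|u(y)|² + (n a_jβ/(n a_j + β))Σ_{y′∈Λ′}|(Q′u)(y′)|²`. [cite: Balaban1984PropagatorsII, (2.41) p.230 + (2.14) p.225] -/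
theorem inner_kForm [Fintype I] [Fintype S] [Fintype J] [DecidableEq I] [DecidableEq J] (hn : n ≠ 0) {α β : ℝ}
    (hα : α ≠ 0) (hαβ : α + β / n ≠ 0) (u : EuclideanSpace ℝ I) :
    ⟪u, kForm (emb ι) (embs ι) (b0Inv σ n α β) α u⟫_ℝ =
      α * (‖u‖ ^ 2 - ‖embs ι u‖ ^ 2) + (n * α * β / (n * α + β)) * ∑ y, Qav σ n (embs ι u) y ^ 2 := by
  have hn' : (n : ℝ) ≠ 0 := Nat.cast_ne_zero.mpr hn
  have hnαβ := n_mul_add_ne_zero n hn hαβ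
  rw [kForm_eq ι σ n hα hαβ]
  simp only [LinearMap.add_apply, LinearMap.smul_apply, LinearMap.sub_apply, LinearMap.id_apply,
    LinearMap.comp_apply, inner_add_right, real_inner_smul_right, inner_sub_right, real_inner_self_eq_norm_sq,
    inner_emb_embs]
  rw [← inner_embs_left, inner_blockProj, norm_Qav_sq]
  have hcoef : α * (β / n) / (α + β / n) * (n : ℝ) = n * α * β / (n * α + β) := by
    field_simp
  rw [← hcoef]
  ring

/-- **`coeff_eq_aSeq_succ` — the recursion of [1]**: with `n = L^d` sub-blocks per block, `β = aL^{d−2}` and `a_j = B1.aSeq a L j`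
(`j ≥ 1`, `a > 0`, `L > 1`), the harmonic-mean coefficient is `n a_jβ/(n a_j + β) = L^{d−2}·a_{j+1}` with
`a_{j+1} = aa_j/(aL^{−2} + a_j) = B1.aSeq a L (j+1)` (*"see [1, 2.13 and 2.15]"*). [cite: Balaban1984PropagatorsII, (2.13)–(2.14) p.225] -/
theorem coeff_eq_aSeq_succ {a L : ℝ} (ha : 0 < a) (hL : 1 < L) (d : ℕ) {j : ℕ} (hj : 1 ≤ j) :
    (L ^ d * B1.aSeq a L j * (a * L ^ d / L ^ 2)) / (L ^ d * B1.aSeq a L j + a * L ^ d / L ^ 2) =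
      L ^ d / L ^ 2 * B1.aSeq a L (j + 1) := by
  have hLpos : 0 < L := by linarith
  have hLd : (0 : ℝ) < L ^ d := pow_pos hLpos d
  have hL2 : (0 : ℝ) < L ^ 2 := pow_pos hLpos 2
  have haj : 0 < B1.aSeq a L j := B1.aSeq_pos ha hL hj
  rw [B1.aSeq_succ ha hL hj]
  have hden : a * (L ^ 2)⁻¹ + B1.aSeq a L j ≠ 0 := by positivity
  have hden2 : L ^ d * B1.aSeq a L j + a * L ^ d / L ^ 2 ≠ 0 := by positivity
  field_simp
  ring

/-- **`inner_kForm_printed` — (2.14) on the cube, levels `j` and `j+1`, in `L^{−j}` units**: for the genuine block structure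
with `L^d` sub-blocks per block, `⟨u,Ku⟩ = a_jΣ_{y∈□^{(j)}∖Λ}|u(y)|² + a_{j+1}L^{d−2}Σ_{y′∈Λ′}|(Q′u)(y′)|²` with `a_j = B1.aSeq a L j`,
`a_{j+1} = B1.aSeq a L (j+1) = aa_j/(aL^{−2}+a_j)` (`L^{d−2}` written `L^d/L²`; first sum = `‖u‖² − ‖u↾_Λ‖²`).
[cite: Balaban1984PropagatorsII, (2.14) p.225 + (2.41) p.230] -/
theorem inner_kForm_printed [Fintype I] [Fintype S] [Fintype J] [DecidableEq I] [DecidableEq J] {a L : ℝ}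
    (ha : 0 < a) (hL : 1 < L) {d j : ℕ} (hj : 1 ≤ j) (hn : (n : ℝ) = L ^ d) (u : EuclideanSpace ℝ I) :
    ⟪u, kForm (emb ι) (embs ι) (b0Inv σ n (B1.aSeq a L j) (a * L ^ d / L ^ 2)) (B1.aSeq a L j) u⟫_ℝ =
      B1.aSeq a L j * (‖u‖ ^ 2 - ‖embs ι u‖ ^ 2) +
        B1.aSeq a L (j + 1) * (L ^ d / L ^ 2) * ∑ y, Qav σ n (embs ι u) y ^ 2 := by
  have hLpos : 0 < L := by linarith
  have hLd : (0 : ℝ) < L ^ d := pow_pos hLpos d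
  have hL2 : (0 : ℝ) < L ^ 2 := pow_pos hLpos 2
  have haj : 0 < B1.aSeq a L j := B1.aSeq_pos ha hL hj
  have hn0 : n ≠ 0 := by
    rintro rfl
    simp only [Nat.cast_zero] at hn
    exact absurd hn.symm hLd.ne'
  have hαβ : B1.aSeq a L j + a * L ^ d / L ^ 2 / n ≠ 0 := by rw [hn]; positivity
  rw [inner_kForm ι σ n hn0 haj.ne' hαβ u, hn, coeff_eq_aSeq_succ ha hL d hj]
  ring

end Identification

/-! ## §4. Consequences: r03's (2.41)–(2.42) now speak of the genuine two-level cube operator -/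

section Consequences

variable {I S J : Type*} [Fintype I] [Fintype S] [Fintype J] [DecidableEq I] [DecidableEq J]
variable {V : Type*} [NormedAddCommGroup V] [InnerProductSpace ℝ V]
variable (ι : S → I) (σ : S → J) (n : ℕ)

/-- **`Δ_□ + Q′*aQ′↾_□` of (2.41) IS the two-level operator of (2.13)–(2.14)**: for any Laplacian `lap` and level-`j`
averaging `Q′_j : V → ℓ²(□^{(j)})` with adjoint `Q′_j*`, r03's `deltaPrimeBox` with the inverse of §2 has the quadratic form
`⟨λ,Δ_□λ⟩ + a_j(‖Q′_jλ‖² − ‖(Q′_jλ)↾_Λ‖²) + (n a_jβ/(n a_j+β))·Σ_{y′∈Λ′}|(Q′(Q′_jλ)↾_Λ)(y′)|²`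
(= `… + a_jΣ_{y∈□^{(j)}∖Λ}|(Q′_jλ)(y)|² + a_{j+1}L^{d−2}Σ_{y′∈Λ′}|(Q′_{j+1}λ)(y′)|²`, `Q′_{j+1} = Q′Q′_j`, by `coeff_eq_aSeq_succ`).
[cite: Balaban1984PropagatorsII, (2.13)–(2.14) p.225 + (2.41) p.230] -/
theorem form_deltaPrimeBox (hn : n ≠ 0) (lap : V →ₗ[ℝ] V) (Qj : V →ₗ[ℝ] EuclideanSpace ℝ I)
    (Qjs : EuclideanSpace ℝ I →ₗ[ℝ] V) (hQ : ∀ (u : EuclideanSpace ℝ I) (v : V), ⟪Qjs u, v⟫_ℝ = ⟪u, Qj v⟫_ℝ)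
    {α β : ℝ} (hα : α ≠ 0) (hαβ : α + β / n ≠ 0) (l : V) :
    ⟪l, deltaPrimeBox lap Qj Qjs (emb ι) (embs ι) (b0Inv σ n α β) α l⟫_ℝ =
      ⟪l, lap l⟫_ℝ + (α * (‖Qj l‖ ^ 2 - ‖embs ι (Qj l)‖ ^ 2) +
        (n * α * β / (n * α + β)) * ∑ y, Qav σ n (embs ι (Qj l)) y ^ 2) := by
  have h : ⟪l, Qjs (kForm (emb ι) (embs ι) (b0Inv σ n α β) α (Qj l))⟫_ℝ =
      ⟪Qj l, kForm (emb ι) (embs ι) (b0Inv σ n α β) α (Qj l)⟫_ℝ := by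
    rw [← real_inner_comm, hQ]
    exact real_inner_comm _ _
  rw [deltaPrimeBox, LinearMap.add_apply, LinearMap.comp_apply, LinearMap.comp_apply, inner_add_right, h,
    inner_kForm ι σ n hn hα hαβ (Qj l)]

omit [Fintype I] in
/-- **`Z_{B₀} = ∫dω e^{−½⟨ω,B₀ω⟩} > 0`** for the genuine `B₀ = aL^{d−2}Q′*Q′ + a_j·1` (`a_j > 0`, `β ≥ 0`) and any additive
Haar (Lebesgue) measure `dω` on `ℓ²(Λ)` — so the ω-representation below is a genuine Gaussian average.
[cite: Balaban1984PropagatorsII, (2.41) p.230] -/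
theorem Z_b0_pos (ν : Measure (EuclideanSpace ℝ S)) [ν.IsAddHaarMeasure] (hι : Function.Injective ι) {α β : ℝ}
    (hα : 0 < α) (hβ : 0 ≤ β) :
    Integrable (fun w => Real.exp (-(1 / 2) * ⟪w, b0 (Bq σ n β) (emb ι) (embs ι) α w⟫_ℝ)) ν ∧
      0 < ∫ w, Real.exp (-(1 / 2) * ⟪w, b0 (Bq σ n β) (emb ι) (embs ι) α w⟫_ℝ) ∂ν := by
  refine B6Eq230GaussianRoute.Z_pos ν _ hα fun w => ?_
  rw [b0, LinearMap.add_apply, LinearMap.smul_apply, LinearMap.comp_apply, embs_emb_apply ι hι, inner_add_right,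
    inner_Bq, real_inner_smul_right, real_inner_self_eq_norm_sq]
  have h : 0 ≤ β * ∑ y, Qav σ n w y ^ 2 := mul_nonneg hβ (Finset.sum_nonneg fun y _ => sq_nonneg _)
  linarith

/-- **`eq241_twoLevel` — (2.41), the ω-integration, for the GENUINE block structure** (r03's `eq241_fibre` with `hE`,
`hBq`, `hB` DISCHARGED): for every level-`j` block field `u` (= `Q′_jλ`) and ANY left-invariant `dω` on `ℓ²(Λ)`,
`∫dω exp[−½aL^{d−2}Σ_{y∈Λ′}|(Q′ω)(y)|² − ½a_j‖emb ω − u‖²] = exp[−½⟨u,Ku⟩]·∫dω e^{−½⟨ω,B₀ω⟩}` with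
`⟨u,Ku⟩ = a_j(‖u‖² − ‖u↾_Λ‖²) + (n a_jβ/(n a_j+β))Σ_{y′}|(Q′u↾_Λ)(y′)|²` (`= a_{j+1}L^{d−2}Σ…` by `coeff_eq_aSeq_succ`).
[cite: Balaban1984PropagatorsII, (2.41) p.230] -/
theorem eq241_twoLevel (ν : Measure (EuclideanSpace ℝ S)) [ν.IsAddLeftInvariant] (hι : Function.Injective ι)
    (hn : n ≠ 0) (hfib : ∀ y : J, (Finset.univ.filter fun s : S => σ s = y).card = n) {α β : ℝ} (hα : α ≠ 0)
    (hαβ : α + β / n ≠ 0) (u : EuclideanSpace ℝ I) :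
    ∫ w, Real.exp (-(1 / 2) * (β * ∑ y, Qav σ n w y ^ 2) - (1 / 2) * α * ‖emb ι w - u‖ ^ 2) ∂ν =
      Real.exp (-(1 / 2) * (α * (‖u‖ ^ 2 - ‖embs ι u‖ ^ 2) +
          (n * α * β / (n * α + β)) * ∑ y, Qav σ n (embs ι u) y ^ 2)) *
        ∫ w, Real.exp (-(1 / 2) * ⟪w, b0 (Bq σ n β) (emb ι) (embs ι) α w⟫_ℝ) ∂ν := by
  have h := B6Eq242LocalPropagator.eq241_fibre ν (emb ι) (embs ι) (Bq σ n β) (b0Inv σ n α β) α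
    (inner_embs_left ι) (inner_Bq_left σ n β) (b0_comp_b0Inv ι σ n hι hn hfib hα hαβ) u
  have hfun : (fun w : EuclideanSpace ℝ S =>
      Real.exp (-(1 / 2) * (β * ∑ y, Qav σ n w y ^ 2) - (1 / 2) * α * ‖emb ι w - u‖ ^ 2)) =
      fun w => Real.exp (-(1 / 2) * ⟪w, Bq σ n β w⟫_ℝ - (1 / 2) * α * ‖emb ι w - u‖ ^ 2) := by
    funext w; rw [inner_Bq]
  rw [hfun, h, inner_kForm ι σ n hn hα hαβ u]

/-- **`eq241_first_line` — the first equality of (2.41) for the genuine two-level cube operator, pointwise in `λ`**: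
`exp[−½⟨λ,(Δ_□+Q′*aQ′↾_□)λ⟩ + ⟨λ,f⟩]·Z_{B₀} = ∫dω exp[−½aL^{d−2}Σ|Q′ω|²]·exp[−½a_j‖ω − Q′_jλ‖² − ½⟨λ,Δ_□λ⟩ + ⟨λ,f⟩]`
(so, integrating `dλ`, the first line of (2.41) is `Z_{B₀}⁻¹ ×` the second line read with `dλ` outside; the printed
order `dω↾_Λ` outside is the same number by Tonelli). [cite: Balaban1984PropagatorsII, (2.41) p.230] -/
theorem eq241_first_line (ν : Measure (EuclideanSpace ℝ S)) [ν.IsAddLeftInvariant] (hι : Function.Injective ι)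
    (hn : n ≠ 0) (hfib : ∀ y : J, (Finset.univ.filter fun s : S => σ s = y).card = n) {α β : ℝ} (hα : α ≠ 0)
    (hαβ : α + β / n ≠ 0) (lap : V →ₗ[ℝ] V) (Qj : V →ₗ[ℝ] EuclideanSpace ℝ I)
    (Qjs : EuclideanSpace ℝ I →ₗ[ℝ] V) (hQ : ∀ (u : EuclideanSpace ℝ I) (v : V), ⟪Qjs u, v⟫_ℝ = ⟪u, Qj v⟫_ℝ)
    (f l : V) :
    Real.exp (-(1 / 2) * ⟪l, deltaPrimeBox lap Qj Qjs (emb ι) (embs ι) (b0Inv σ n α β) α l⟫_ℝ + ⟪l, f⟫_ℝ) *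
        ∫ w, Real.exp (-(1 / 2) * ⟪w, b0 (Bq σ n β) (emb ι) (embs ι) α w⟫_ℝ) ∂ν =
      ∫ w, Real.exp (-(1 / 2) * (β * ∑ y, Qav σ n w y ^ 2)) *
        Real.exp (-(1 / 2) * α * ‖emb ι w - Qj l‖ ^ 2 - (1 / 2) * ⟪l, lap l⟫_ℝ + ⟪l, f⟫_ℝ) ∂ν := by
  have hprod : (fun w : EuclideanSpace ℝ S => Real.exp (-(1 / 2) * (β * ∑ y, Qav σ n w y ^ 2)) *
      Real.exp (-(1 / 2) * α * ‖emb ι w - Qj l‖ ^ 2 - (1 / 2) * ⟪l, lap l⟫_ℝ + ⟪l, f⟫_ℝ)) =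
      fun w => Real.exp (-(1 / 2) * ⟪l, lap l⟫_ℝ + ⟪l, f⟫_ℝ) *
        Real.exp (-(1 / 2) * (β * ∑ y, Qav σ n w y ^ 2) - (1 / 2) * α * ‖emb ι w - Qj l‖ ^ 2) := by
    funext w
    rw [← Real.exp_add, ← Real.exp_add]
    congr 1
    ring
  rw [hprod, integral_const_mul, eq241_twoLevel ι σ n ν hι hn hfib hα hαβ (Qj l), ← mul_assoc, ← Real.exp_add,
    form_deltaPrimeBox ι σ n hn lap Qj Qjs hQ hα hαβ l]
  congr 2
  ring

omit [Fintype I] [Fintype J] in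
/-- **`deltaPrimeBox_comp_gPrimeBox_twoLevel` — (2.42): the Woodbury `G′(□) = G′_j(□) + a_j²G′_j(□)Q′_j*emb C_Λ^{(j)}(□) embs Q′_jG′_j(□)`
is a right inverse of the GENUINE two-level `Δ_□ + Q′*aQ′↾_□`** (r03's `deltaPrimeBox_comp_gPrimeBox` with `hB` discharged;
`G′_j(□)` a right inverse of `M_j = Δ_□ + a_jQ′_j*Q′_j`, `C_Λ^{(j)}(□)` a right inverse of `B₀ − a_j²embs Q′_jG′_j(□)Q′_j*emb`
remain the two analytic inputs of [3] Lemma 2.2 / Prop. 2.3). [cite: Balaban1984PropagatorsII, (2.42) p.230] -/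
theorem deltaPrimeBox_comp_gPrimeBox_twoLevel (hι : Function.Injective ι) (hn : n ≠ 0)
    (hfib : ∀ y : J, (Finset.univ.filter fun s : S => σ s = y).card = n) {α β : ℝ} (hα : α ≠ 0)
    (hαβ : α + β / n ≠ 0) (lap Gj : V →ₗ[ℝ] V) (Qj : V →ₗ[ℝ] EuclideanSpace ℝ I)
    (Qjs : EuclideanSpace ℝ I →ₗ[ℝ] V) (C : EuclideanSpace ℝ S →ₗ[ℝ] EuclideanSpace ℝ S)
    (hG : mj lap Qj Qjs α ∘ₗ Gj = LinearMap.id)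
    (hC : cInv Qj Qjs (emb ι) (embs ι) (Bq σ n β) Gj α ∘ₗ C = LinearMap.id) :
    deltaPrimeBox lap Qj Qjs (emb ι) (embs ι) (b0Inv σ n α β) α ∘ₗ
        gPrimeBox Qj Qjs (emb ι) (embs ι) Gj C α = LinearMap.id :=
  B6Eq242LocalPropagator.deltaPrimeBox_comp_gPrimeBox lap Qj Qjs (emb ι) (embs ι) (Bq σ n β) (b0Inv σ n α β) Gj C α
    hG (b0Inv_comp_b0 ι σ n hι hn hfib hα hαβ) hC

end Consequences

end Literature.MathematicalPhysics.QuantumFieldTheory.Balaban1983to89.B6Eq241TwoLevelWeights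

/-! ## §5. Non-vacuity: the product block structure `Λ = Λ′ × {1,…,n}` meets `hfib` -/

namespace Literature.MathematicalPhysics.QuantumFieldTheory.Balaban1983to89.B6Eq241TwoLevelWeights

/-- the genuine geometry is an instance: labelling the `n = L^d` level-`j` blocks of each `(j+1)`-block `y ∈ Λ′` by
`(y, t)`, `t ∈ Fin n`, the block map `σ = Prod.fst` has every fibre of cardinality `n` (`hfib`), so every hypothesis of
§§2–4 is met by the cube geometry of (2.41). [cite: Balaban1984PropagatorsII, (2.41) p.230] -/
theorem hfib_prod {J : Type*} [Fintype J] [DecidableEq J] (n : ℕ) (y : J) :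
    (Finset.univ.filter fun s : J × Fin n => s.1 = y).card = n := by
  rw [show (Finset.univ.filter fun s : J × Fin n => s.1 = y) =
      ({y} : Finset J) ×ˢ (Finset.univ : Finset (Fin n)) by
    ext ⟨a, b⟩
    simp [eq_comm]]
  simp

end Literature.MathematicalPhysics.QuantumFieldTheory.Balaban1983to89.B6Eq241TwoLevelWeights
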